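import Literature.Computability.Complexity.CodeFPArith
import HarnessLib

/-!
# Crux `ArithStatLadder.IqThreeNotBPP` (stmt-QuantumAdvantage-14864)

Stub `stub_samplerCubeFP` of the line `Sketch` (skeleton v3, UNIFORM SQUAREFREE-FILTER DOMINATION):
the planted sampler of the reduction `SQUAREFREES ≤ IQ3` is an `FP` string function.

On an input pair `⟨x, r⟩` (numeral `x` of value `N = bitsToNat x` and bit length `n = |x|`, seed
`r` of value `j = bitsToNat r`) the sampler outputs the canonical numeral of
`d = 0` if `4 ∣ N`, else `d = 4 · M · s · (2 U³ − M s)` (truncated subtraction), where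
`M = N / 2` for even `N` and `M = N` otherwise, `U = 6 · M · 2^{3n+32} ∓ 1` (`−` iff `M ≡ 2 (mod 3)`)
and `s = 1 + 6 · M · U · j`.

The witness is an explicit composition in the tree's typed `CodeFP` algebra (`CodeFP.lean`,
`CodeFPArith.lean`): the values `N`, `j` by `CodeFP.strVal`, the length `n` in unary by
`CodeFP.strLength` and `3n + 32` by unary additions, the power `2^{3n+32}` and the cube `U³` by
`CodeFP.natPow` (unary exponents), the three case distinctions by `CodeFP.natEq`/`CodeFP.ite`
(`codeFP_iteNatEq`), and the ring operations by `CodeFP.natAdd`/`natSub`/`natMul`/`natDiv`/`natMod`.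
No machine is written.
-/

noncomputable section

set_option linter.dupNamespace false -- D-0017: single-problem summit ⇒ `QuantumAdvantage.QuantumAdvantage` by design

namespace Summit.QuantumAdvantage.QuantumAdvantage.Theorems.IqThreeNotBPP

open _root_.Computability Literature.Computability.Complexity
open Literature.Computability.Complexity.CodeFP (strE unE natE bitE pairE natAdd natSub natMul natDiv
  natMod natEq natPow const fst snd strVal strLength unAdd)

variable {α β : Type} {eα : α → List Bool} {eβ : β → List Bool}

/-! ### Generic pieces of the typed `CodeFP` algebra -/

/-- **Branching on an equality test of two computed numerals** (`CodeFP.natEq` feeding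
`CodeFP.ite`, the computed bit `decide (u = v)` read back as the proposition `u = v`). [folklore] -/
private theorem codeFP_iteNatEq {u v : α → ℕ} {g h : α → β} (hu : CodeFP eα natE u)
    (hv : CodeFP eα natE v) (hg : CodeFP eα eβ g) (hh : CodeFP eα eβ h) :
    CodeFP eα eβ (fun a => if u a = v a then g a else h a) :=
  ((natEq.comp (hu.pair hv)).ite hg hh).congr fun a => by
    by_cases hc : u a = v a
    · simp [hc]
    · simp [hc]

/-- `1ⁿ ↦ 1^{3n+32}`: the exponent of the sampler, in unary (three concatenations and a constant
block). [folklore] -/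
private theorem codeFP_unExp : CodeFP unE unE (fun n => 3 * n + 32) :=
  (unAdd.comp₂ (unAdd.comp₂ (unAdd.comp₂ (CodeFP.id unE) (CodeFP.id unE)) (CodeFP.id unE))
    (const unE 32)).congr fun n => by
    show n + n + n + 32 = 3 * n + 32
    omega

/-! ### The sampler's arithmetic on codes -/

/-- `M = N / 2` for even `N`, else `N`, for a computed numeral `N`. [folklore] -/
private theorem codeFP_half {N : α → ℕ} (hN : CodeFP eα natE N) :
    CodeFP eα natE (fun a => if N a % 2 = 0 then N a / 2 else N a) :=
  codeFP_iteNatEq (natMod.comp₂ hN (const _ 2)) (const _ 0) (natDiv.comp₂ hN (const _ 2)) hN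

/-- `U = 6 M P − 1` if `M ≡ 2 (mod 3)`, else `6 M P + 1`, for computed numerals `M`, `P`. [folklore] -/
private theorem codeFP_unit {M P : α → ℕ} (hM : CodeFP eα natE M) (hP : CodeFP eα natE P) :
    CodeFP eα natE (fun a => if M a % 3 = 2 then 6 * M a * P a - 1 else 6 * M a * P a + 1) := by
  have h6 : CodeFP eα natE (fun a => 6 * M a * P a) := natMul.comp₂ (natMul.comp₂ (const _ 6) hM) hP
  exact codeFP_iteNatEq (natMod.comp₂ hM (const _ 3)) (const _ 2) (natSub.comp₂ h6 (const _ 1))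
    (natAdd.comp₂ h6 (const _ 1))

/-- `s = 1 + 6 M U j` for computed numerals `M`, `U`, `j`. [folklore] -/
private theorem codeFP_seed {M U j : α → ℕ} (hM : CodeFP eα natE M) (hU : CodeFP eα natE U)
    (hj : CodeFP eα natE j) : CodeFP eα natE (fun a => 1 + 6 * M a * U a * j a) :=
  natAdd.comp₂ (const _ 1) (natMul.comp₂ (natMul.comp₂ (natMul.comp₂ (const _ 6) hM) hU) hj)

/-- `4 M s (2U³ − M s)` (truncated subtraction; the cube by `CodeFP.natPow` with the unary
exponent `3`) for computed numerals `M`, `U`, `s`. [folklore] -/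
private theorem codeFP_core {M U s : α → ℕ} (hM : CodeFP eα natE M) (hU : CodeFP eα natE U)
    (hs : CodeFP eα natE s) :
    CodeFP eα natE (fun a => 4 * (M a * s a * (2 * U a ^ 3 - M a * s a))) :=
  natMul.comp₂ (const _ 4) (natMul.comp₂ (natMul.comp₂ hM hs)
    (natSub.comp₂ (natMul.comp₂ (const _ 2) (natPow.comp₂ hU (const _ 3))) (natMul.comp₂ hM hs)))

/-- **The sampler on codes**: `⟨x, r⟩ ↦ d` is computed by an `FP` string function between the pair
code `pairE strE strE` (which is `boolPair`) and binary numerals. [folklore] -/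
private theorem codeFP_sampler :
    CodeFP (pairE strE strE) natE (fun a : List Bool × List Bool =>
      let N := bitsToNat a.1
      let n := a.1.length
      let j := bitsToNat a.2
      let M := if N % 2 = 0 then N / 2 else N
      let U := if M % 3 = 2 then 6 * M * 2 ^ (3 * n + 32) - 1 else 6 * M * 2 ^ (3 * n + 32) + 1
      let s := 1 + 6 * M * U * j
      if N % 4 = 0 then 0 else 4 * (M * s * (2 * U ^ 3 - M * s))) := by
  have hx : CodeFP (pairE strE strE) strE (fun a : List Bool × List Bool => a.1) := fst _ _
  -- the values `N`, `j`
  have hN : CodeFP (pairE strE strE) natE (fun a : List Bool × List Bool => bitsToNat a.1) :=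
    strVal.comp hx
  have hj : CodeFP (pairE strE strE) natE (fun a : List Bool × List Bool => bitsToNat a.2) :=
    strVal.comp (snd _ _)
  -- `P = 2^{3n+32}` through the unary exponent `3|x| + 32`
  have hP : CodeFP (pairE strE strE) natE
      (fun a : List Bool × List Bool => 2 ^ (3 * a.1.length + 32)) :=
    natPow.comp₂ (const _ 2) (codeFP_unExp.comp (strLength.comp hx))
  -- `M`, `U`, `s`, and the final case distinction on `4 ∣ N`
  have hM := codeFP_half hN
  have hU := codeFP_unit hM hP
  have hs := codeFP_seed hM hU hj
  exact codeFP_iteNatEq (natMod.comp₂ hN (const _ 4)) (const _ 0) (const _ 0) (codeFP_core hM hU hs)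

/-! ### The registered stub -/

/-- **STUB F · `stub_samplerCubeFP`** (CodeFP algebra): the planted sampler of the line — on
`⟨x, r⟩` with `N = bitsToNat x`, `n = |x|`, `j = bitsToNat r`, `M = N/2` (`N` even) else `N`,
`U = 6 M 2^{3n+32} ∓ 1` (`−` iff `M ≡ 2 (mod 3)`), `s = 1 + 6 M U j`, output the numeral of
`0` if `4 ∣ N` and of `4 M s (2U³ − M s)` otherwise — is an `FP` string function of `boolPair x r`. -/
theorem stub_samplerCubeFP :
    ∃ f : List Bool → List Bool, f ∈ FP ∧ ∀ x r : List Bool,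
      f (boolPair x r) = encodeNat
        (let N := bitsToNat x
         let n := x.length
         let j := bitsToNat r
         let M := if N % 2 = 0 then N / 2 else N
         let U := if M % 3 = 2 then 6 * M * 2 ^ (3 * n + 32) - 1 else 6 * M * 2 ^ (3 * n + 32) + 1
         let s := 1 + 6 * M * U * j
         if N % 4 = 0 then 0 else 4 * (M * s * (2 * U ^ 3 - M * s))) := by
  obtain ⟨f, hf, hval⟩ := codeFP_sampler
  exact ⟨f, hf, fun x r => hval (x, r)⟩

end Summit.QuantumAdvantage.QuantumAdvantage.Theorems.IqThreeNotBPP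

end
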